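import Mathlib
import Summits.Ventures.PercRepro2.ThreeTermPartFibre

/-!
# Three-terminal parts, V a: the per-copy pinned count as a sum over the typed assignments
(blind cell PercRepro2, night-3 g30, 2026-08-29; `proofs/NIGHT3-CERT.md` §39.6)

`typedCount3 F z₁ z₂ z₃ τ K` (TypedStarSplit.lean) sums `K` over the triples of configurations that agree
with the per-copy pins `z₁ z₂ z₃` off `F` and carry `τ` open copies on each edge of `F`.  Such a triple is
determined by its restriction to `F`, so the count is a sum over the TYPED ASSIGNMENTS on `F` — the
configurations `(a, b, c)` supported on `F` with open counts `τ` — of `K` at the pinned configurations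
`setOn F a z₁`, `setOn F b z₂`, `setOn F c z₃` (`typedCount3_eq_sum_setOn`; the per-copy analogue of
`typedCount_split` with `F = ∅`).  Also: the count reads `τ` on `F` only (`typedCount3_congr_τ`), and
so does the partition table `partTable5` (`partTable5_congr_τ`).  These are the bookkeeping lemmas that
let the kernel evaluate a concrete core's table (ThreeTermInstanceHOB.lean).  Own work; standard axioms.
-/

namespace Summit.Ventures.PercRepro2

open TypedStar

namespace Part

section Cube

variable {E : Type*} [Fintype E] [DecidableEq E] {R : Type*} [CommRing R]

omit [Fintype E] in
/-- The pinned-triple condition of `typedCount3` for `(setOn F a z₁, …)` against a typed assignment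
`(a, b, c)`: the assignment is the restriction and the triple is pinned and typed. -/
lemma cond3_pin_iff (F : Finset E) (z₁ z₂ z₃ : Config E) (τ : E → ℕ) (a b c x y w : Config E) :
    (((SuppOn F a ∧ SuppOn F b ∧ SuppOn F c) ∧ (∀ e ∈ F, openCount a b c e = τ e)) ∧
        (x = setOn F a z₁ ∧ y = setOn F b z₂ ∧ w = setOn F c z₃)) ↔
      ((a = restrictTo F x ∧ b = restrictTo F y ∧ c = restrictTo F w) ∧
        ((∀ e, e ∉ F → x e = z₁ e ∧ y e = z₂ e ∧ w e = z₃ e) ∧ (∀ e ∈ F, openCount x y w e = τ e))) := by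
  constructor
  · rintro ⟨⟨⟨ha, hb, hc⟩, hF⟩, rfl, rfl, rfl⟩
    refine ⟨⟨?_, ?_, ?_⟩, ?_, ?_⟩
    · exact eq_restrictTo_of_suppOn ha (fun e he => setOn_of_mem he a z₁)
    · exact eq_restrictTo_of_suppOn hb (fun e he => setOn_of_mem he b z₂)
    · exact eq_restrictTo_of_suppOn hc (fun e he => setOn_of_mem he c z₃)
    · intro e he
      simp only [setOn_of_not_mem he, and_self]
    · intro e he
      simp only [openCount, setOn_of_mem he]
      exact hF e he
  · rintro ⟨⟨rfl, rfl, rfl⟩, hoff, hF⟩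
    refine ⟨⟨⟨suppOn_restrictTo F x, suppOn_restrictTo F y, suppOn_restrictTo F w⟩, ?_⟩, ?_, ?_, ?_⟩
    · intro e he
      rw [openCount_restrictTo he]
      exact hF e he
    · funext e
      by_cases he : e ∈ F
      · rw [setOn_of_mem he, restrictTo_of_mem he]
      · rw [setOn_of_not_mem he, (hoff e he).1]
    · funext e
      by_cases he : e ∈ F
      · rw [setOn_of_mem he, restrictTo_of_mem he]
      · rw [setOn_of_not_mem he, (hoff e he).2.1]
    · funext e
      by_cases he : e ∈ F
      · rw [setOn_of_mem he, restrictTo_of_mem he]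
      · rw [setOn_of_not_mem he, (hoff e he).2.2]

/-- The unique-witness sum: for a fixed triple `(x, y, w)`, exactly one typed assignment — the
restrictions — contributes. -/
lemma sum_assign_eq (F : Finset E) (z₁ z₂ z₃ : Config E) (τ : E → ℕ)
    (K : Config E → Config E → Config E → R) (x y w : Config E) :
    (∑ p : Config E × Config E × Config E,
      if ((SuppOn F p.1 ∧ SuppOn F p.2.1 ∧ SuppOn F p.2.2) ∧ (∀ e ∈ F, openCount p.1 p.2.1 p.2.2 e = τ e)) ∧
          (x = setOn F p.1 z₁ ∧ y = setOn F p.2.1 z₂ ∧ w = setOn F p.2.2 z₃) then K x y w else 0) =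
      if (∀ e, e ∉ F → x e = z₁ e ∧ y e = z₂ e ∧ w e = z₃ e) ∧ (∀ e ∈ F, openCount x y w e = τ e)
        then K x y w else 0 := by
  rw [Finset.sum_eq_single (restrictTo F x, restrictTo F y, restrictTo F w)]
  · simp only [cond3_pin_iff F z₁ z₂ z₃ τ, true_and]
  · intro p _ hp
    rw [if_neg]
    intro hc
    apply hp
    have := (cond3_pin_iff F z₁ z₂ z₃ τ p.1 p.2.1 p.2.2 x y w).mp hc
    obtain ⟨⟨h1, h2, h3⟩, _⟩ := this
    exact Prod.ext h1 (Prod.ext h2 h3)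
  · intro h
    exact absurd (Finset.mem_univ _) h

/-- A triple sum over configurations as one sum over the product type. -/
lemma flatten3' (g : Config E → Config E → Config E → R) :
    (∑ a : Config E, ∑ b : Config E, ∑ c : Config E, g a b c) =
      ∑ p : Config E × Config E × Config E, g p.1 p.2.1 p.2.2 := by
  simp only [Fintype.sum_prod_type]

/-- Moving an outer sum past three inner sums. -/
lemma sum_comm_out' {P : Type*} [Fintype P] (f : P → Config E → Config E → Config E → R) :
    (∑ p : P, ∑ x : Config E, ∑ y : Config E, ∑ w : Config E, f p x y w) =
      ∑ x : Config E, ∑ y : Config E, ∑ w : Config E, ∑ p : P, f p x y w := by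
  rw [Finset.sum_comm]
  refine Finset.sum_congr rfl fun x _ => ?_
  rw [Finset.sum_comm]
  refine Finset.sum_congr rfl fun y _ => ?_
  rw [Finset.sum_comm]

/-- **The per-copy pinned count is the sum over the typed assignments on `F`** of `K` at the pinned
configurations. -/
theorem typedCount3_eq_sum_setOn (F : Finset E) (z₁ z₂ z₃ : Config E) (τ : E → ℕ)
    (K : Config E → Config E → Config E → R) :
    typedCount3 F z₁ z₂ z₃ τ K =
      ∑ a : Config E, ∑ b : Config E, ∑ c : Config E,
        if (SuppOn F a ∧ SuppOn F b ∧ SuppOn F c) ∧ (∀ e ∈ F, openCount a b c e = τ e)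
          then K (setOn F a z₁) (setOn F b z₂) (setOn F c z₃) else 0 := by
  -- write each assignment's term as a sum over the triples it pins, with a unique witness
  have step : ∀ a b c : Config E,
      (if (SuppOn F a ∧ SuppOn F b ∧ SuppOn F c) ∧ (∀ e ∈ F, openCount a b c e = τ e)
        then K (setOn F a z₁) (setOn F b z₂) (setOn F c z₃) else 0) =
      ∑ x : Config E, ∑ y : Config E, ∑ w : Config E,
        (if ((SuppOn F a ∧ SuppOn F b ∧ SuppOn F c) ∧ (∀ e ∈ F, openCount a b c e = τ e)) ∧
            (x = setOn F a z₁ ∧ y = setOn F b z₂ ∧ w = setOn F c z₃) then K x y w else 0) := by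
    intro a b c
    by_cases h : (SuppOn F a ∧ SuppOn F b ∧ SuppOn F c) ∧ (∀ e ∈ F, openCount a b c e = τ e)
    · rw [if_pos h]
      rw [Finset.sum_eq_single (setOn F a z₁)]
      · rw [Finset.sum_eq_single (setOn F b z₂)]
        · rw [Finset.sum_eq_single (setOn F c z₃)]
          · rw [if_pos ⟨h, rfl, rfl, rfl⟩]
          · intro w _ hw
            rw [if_neg (fun h' => hw h'.2.2.2)]
          · intro h'; exact absurd (Finset.mem_univ _) h'
        · intro y _ hy
          exact Finset.sum_eq_zero fun w _ => by rw [if_neg (fun h' => hy h'.2.2.1)]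
        · intro h'; exact absurd (Finset.mem_univ _) h'
      · intro x _ hx
        exact Finset.sum_eq_zero fun y _ => Finset.sum_eq_zero fun w _ => by
          rw [if_neg (fun h' => hx h'.2.1)]
      · intro h'; exact absurd (Finset.mem_univ _) h'
    · rw [if_neg h]
      symm
      exact Finset.sum_eq_zero fun x _ => Finset.sum_eq_zero fun y _ => Finset.sum_eq_zero fun w _ => by
        rw [if_neg (fun h' => h h'.1)]
  simp only [step]
  rw [flatten3', sum_comm_out']
  unfold typedCount3
  refine Finset.sum_congr rfl fun x _ => Finset.sum_congr rfl fun y _ => Finset.sum_congr rfl fun w _ => ?_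
  exact (sum_assign_eq F z₁ z₂ z₃ τ K x y w).symm

omit [Fintype E] in
/-- `typedCount3` reads `τ` on `F` only. -/
lemma typedCount3_congr_τ [Fintype E] (F : Finset E) (z₁ z₂ z₃ : Config E) {τ τ' : E → ℕ}
    (h : ∀ e ∈ F, τ e = τ' e) (K : Config E → Config E → Config E → R) :
    typedCount3 F z₁ z₂ z₃ τ K = typedCount3 F z₁ z₂ z₃ τ' K := by
  unfold typedCount3
  refine Finset.sum_congr rfl fun x _ => Finset.sum_congr rfl fun y _ => Finset.sum_congr rfl fun w _ => ?_
  have : (∀ e ∈ F, openCount x y w e = τ e) ↔ (∀ e ∈ F, openCount x y w e = τ' e) :=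
    ⟨fun h' e he => (h' e he).trans (h e he), fun h' e he => (h' e he).trans (h e he).symm⟩
  rw [if_congr (and_congr_right' this) rfl rfl]

end Cube

section Table

variable {V : Type*} {E : Type*} [Fintype E] [DecidableEq E]

/-- The partition table reads `τ` on `F` only. -/
lemma partTable5_congr_τ (ends : E → Sym2 V) (S : Finset E) (e₁ e₂ e₃ : E) (t₁ t₂ t₃ : V)
    (o a₁ a₂ a₃ b : V) (F : Finset E) (z : Config E) {τ τ' : E → ℕ} (h : ∀ e ∈ F, τ e = τ' e)
    (p q r : Fin 5) :
    partTable5 ends S e₁ e₂ e₃ t₁ t₂ t₃ o a₁ a₂ a₃ b F z τ p q r =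
      partTable5 ends S e₁ e₂ e₃ t₁ t₂ t₃ o a₁ a₂ a₃ b F z τ' p q r := by
  unfold partTable5 partTable
  exact typedCount3_congr_τ F _ _ _ h _

end Table

end Part

end Summit.Ventures.PercRepro2
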